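import Mathlib
import HarnessLib
import Summits.NavierStokesRegularity.NavierStokesRegularity.Theorems.PoloidalWindowDoorPoloidalWindowRigidityZShockThInstantAbsorbed

/-!
# Crux K2 `PoloidalWindowRigidity` (stmt-NavierStokesRegularity-19708), line `z_shock` — ★ THE DECIDING STUB `stub_zShockThickAut`
# VERBATIM ⟸ the class-free slice Liouville statement `hGN` + the REGISTERED residue stub `stub_mixedPocketThick` (no (TH)-instant residue)

`--supports stmt-NavierStokesRegularity-19708 --as helper` (leafhand-ns-poloidalwindowdoor-3 g16, cell decomp-ns, 2026-09-01).  Def-free;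
pure case analysis over `…ZShockThInstantAbsorbed` (same hand).  **No stub and no summit is closed by this file; Navier–Stokes regularity
is NOT proved here (rung 0).**

g12's `…ZShockAutReduction.stub_zShockThickAut_of_sliceLiouville_of_thInstant` = deciding stub ⟸ `hGN` + `hTH` ((TH)-instant residue,
booked by every census since as «needs the (TH)-column dynamics»).  Here the residue is ABSORBED by the mixed-pocket stub the skeleton
already carries:

* ★ `stub_zShockThickAut_of_sliceLiouville_of_mixedPocket` — the registered type of `stub_zShockThickAut` (skeleton sha16 c3e8eee2)
  VERBATIM ⟸ `hGN` (VERBATIM g12's class-free statement about ONE real-analytic vector field on `ℝ³`) ∧ `hPocket` (the registered type of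
  `stub_mixedPocketThick` VERBATIM).  Proof: either some window point `z₁` has a densely hyperbolic slice with a genuinely nonlinear point —
  `…ZShockThInstantAbsorbed.false_of_sliceLiouville_of_gnPoint` at `t = z₁.1` (the stub's autonomy clause near `z₀` feeds the slab-global
  minors) — or every densely hyperbolic window time is a (TH)-instant — `…ZShockThInstantAbsorbed.exists_pocketWindow_of_thInstants` gives a
  sub-window on which `hPocket` applies with all window clauses restricted.  The stub's own `hdense` at `z₀` is not even used.
* `hyperbolicThick_of_sliceLiouville` — consequently `mixed_type`'s `stub_hyperbolicThick` (`hHT`, VERBATIM; = the skeleton's node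
  `hyperbolicThick_of_zShock`) ⟸ `hGN` ∧ `hMod` (`stub_zShockThickMod` VERBATIM) ∧ `hPocket`: the skeleton's own split
  (`zShockThick_of_autSplit`, `hyperbolicThick_of_zShock`) with the deciding stub discharged by the first theorem and NO new residue.

PLANNER-FACING CONSEQUENCE: the deciding stub of `z_shock` can be REGISTERED CLASS-FREE — `stub_sliceLiouville := hGN` (one analytic,
bounded, bounded-gradient, divergence-free, e₃-poloidal field on `ℝ³` with the wedge law, vanishing autonomy minors, no strictly elliptic
point, one hyperbolic / twisting / genuinely nonlinear point ⟹ `False`) — in place of `stub_zShockThickAut`, the composition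
`PoloidalWindowRigidity_of_zShock` going through `hyperbolicThick_of_sliceLiouville` unchanged otherwise; the residues `hTH` / `hTV₀` /
`hTV₀M` of `…ZShockAutReduction` / `…ZShockThInstantSlope` / `…ZShockMinorsSplit` drop out of the repair census.
HONEST LABEL: bookkeeping in the kernel; closes no stub; `hGN` is XL (not in print). [folklore]
-/

namespace Summit.NavierStokesRegularity.NavierStokesRegularity.Theorems.PoloidalWindowDoorPoloidalWindowRigidityZShockAutOfSliceLiouville

-- the problem directory repeats the summit name (`NavierStokesRegularity/NavierStokesRegularity`)
set_option linter.dupNamespace false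

open Set Filter Topology Function Metric
open scoped RealInnerProductSpace InnerProductSpace
open Literature.Analysis Literature.Analysis.FluidPDE
open Summit.NavierStokesRegularity.NavierStokesRegularity.Theorems.PoloidalWindowDoorPoloidalWindowRigidityZShockThInstantAbsorbed

/-- ★ **The deciding stub `stub_zShockThickAut` of skeleton `z_shock` (sha16 c3e8eee2), VERBATIM, from the class-free slice Liouville
statement `hGN` and the REGISTERED residue stub `stub_mixedPocketThick` (`hPocket`, VERBATIM) — no (TH)-instant / constant-slope
residue.**  Proof: either some window point `z₁` has a densely hyperbolic slice with a genuinely nonlinear point — then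
`false_of_sliceLiouville_of_gnPoint` at `t = z₁.1` (the autonomy clause near the stub's `z₀` feeds the slab-global minors); or every
densely hyperbolic window time is a (TH)-instant — then `exists_pocketWindow_of_thInstants` gives a sub-window on which `hPocket` applies
with all window clauses restricted. [folklore] -/
theorem stub_zShockThickAut_of_sliceLiouville_of_mixedPocket
    (hGN : ∀ (u : EuclideanSpace ℝ (Fin 3) → EuclideanSpace ℝ (Fin 3)),
      AnalyticOnNhd ℝ u Set.univ →
      (∃ M : ℝ, ∀ x, ‖u x‖ ≤ M) →
      (∃ M₁ : ℝ, ∀ x, ‖fderiv ℝ u x‖ ≤ M₁) →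
      Literature.Analysis.FluidPDE.VectorCalculus.IsDivFree u →
      (∀ y, ⟪Literature.Analysis.FluidPDE.curl u y, EuclideanSpace.single 2 1⟫_ℝ = 0) →
      (∀ y, fderiv ℝ u y (EuclideanSpace.single 2 1) 0 * fderiv ℝ u y (EuclideanSpace.single 1 1) 2 -
        fderiv ℝ u y (EuclideanSpace.single 2 1) 1 * fderiv ℝ u y (EuclideanSpace.single 0 1) 2 = 0) →
      (∀ b : Fin 3, b ≠ 2 → ∀ x p q : EuclideanSpace ℝ (Fin 3),
        (fderiv ℝ u x (EuclideanSpace.single b 1) 2 *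
              fderiv ℝ (fun y => fderiv ℝ u y (EuclideanSpace.single 2 1) b) x p -
            fderiv ℝ u x (EuclideanSpace.single 2 1) b *
              fderiv ℝ (fun y => fderiv ℝ u y (EuclideanSpace.single b 1) 2) x p) *
            fderiv ℝ (fun y => u y 2) x q -
          (fderiv ℝ u x (EuclideanSpace.single b 1) 2 *
              fderiv ℝ (fun y => fderiv ℝ u y (EuclideanSpace.single 2 1) b) x q -
            fderiv ℝ u x (EuclideanSpace.single 2 1) b *
              fderiv ℝ (fun y => fderiv ℝ u y (EuclideanSpace.single b 1) 2) x q) *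
            fderiv ℝ (fun y => u y 2) x p = 0) →
      (∀ y, fderiv ℝ u y (EuclideanSpace.single 2 1) 0 * fderiv ℝ u y (EuclideanSpace.single 0 1) 2 +
        fderiv ℝ u y (EuclideanSpace.single 2 1) 1 * fderiv ℝ u y (EuclideanSpace.single 1 1) 2 ≤ 0) →
      (∃ y, fderiv ℝ u y (EuclideanSpace.single 2 1) 0 * fderiv ℝ u y (EuclideanSpace.single 0 1) 2 +
        fderiv ℝ u y (EuclideanSpace.single 2 1) 1 * fderiv ℝ u y (EuclideanSpace.single 1 1) 2 < 0) →
      (∃ y, fderiv ℝ (fun x => fderiv ℝ u x (EuclideanSpace.single 2 1) 2) y (EuclideanSpace.single 0 1) *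
            fderiv ℝ u y (EuclideanSpace.single 1 1) 2 -
          fderiv ℝ (fun x => fderiv ℝ u x (EuclideanSpace.single 2 1) 2) y (EuclideanSpace.single 1 1) *
            fderiv ℝ u y (EuclideanSpace.single 0 1) 2 ≠ 0) →
      (∃ b : Fin 3, b ≠ 2 ∧ ∃ x p : EuclideanSpace ℝ (Fin 3),
        fderiv ℝ u x (EuclideanSpace.single b 1) 2 *
            fderiv ℝ (fun y => fderiv ℝ u y (EuclideanSpace.single 2 1) b) x p -
          fderiv ℝ u x (EuclideanSpace.single 2 1) b *
            fderiv ℝ (fun y => fderiv ℝ u y (EuclideanSpace.single b 1) 2) x p ≠ 0) →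
      False)
    (hPocket : ∀ (C : ℝ) (v : ℝ → EuclideanSpace ℝ (Fin 3) → EuclideanSpace ℝ (Fin 3)),
        Literature.Analysis.FluidPDE.HasTypeITimeDecay C v →
        ContinuousOn (Function.uncurry v) (Set.Iio (0 : ℝ) ×ˢ Set.univ) →
        (∀ s t : ℝ, s < t → t < 0 → ∀ x, v t x =
          Literature.Analysis.UnboundedOperators.heatExtension (v s) (t - s) x -
            Literature.Analysis.FluidPDE.oseenDuhamel 1 s v v t x) →
        (∀ t < 0, Literature.Analysis.FluidPDE.VectorCalculus.IsDivFree (v t)) →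
        (∀ s < 0, ∀ y, ⟪Literature.Analysis.FluidPDE.curl (v s) y, EuclideanSpace.single 2 1⟫_ℝ = 0) →
        ∀ W : Set (ℝ × EuclideanSpace ℝ (Fin 3)), IsOpen W → W.Nonempty → W ⊆ Set.Iio (0 : ℝ) ×ˢ Set.univ →
          (∀ z ∈ W, Literature.Analysis.FluidPDE.curl (v z.1) z.2 ≠ 0 ∧
            (fderiv ℝ (v z.1) z.2 (EuclideanSpace.single 0 1) 2 ≠ 0 ∨ fderiv ℝ (v z.1) z.2 (EuclideanSpace.single 1 1) 2 ≠ 0) ∧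
            (fderiv ℝ (v z.1) z.2 (EuclideanSpace.single 2 1) 0 ≠ 0 ∨ fderiv ℝ (v z.1) z.2 (EuclideanSpace.single 2 1) 1 ≠ 0)) →
          (∀ m : ℝ → ℝ, ∀ W₁ : Set (ℝ × EuclideanSpace ℝ (Fin 3)), W₁ ⊆ W → IsOpen W₁ → W₁.Nonempty →
            ∃ z ∈ W₁, ∃ b : Fin 3, b ≠ 2 ∧
              fderiv ℝ (v z.1) z.2 (EuclideanSpace.single 2 1) b ≠
                m z.1 * fderiv ℝ (v z.1) z.2 (EuclideanSpace.single b 1) 2) →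
          (∀ z ∈ W,
            fderiv ℝ (fun x => fderiv ℝ (v z.1) x (EuclideanSpace.single 2 1) 2) z.2 (EuclideanSpace.single 0 1) *
                fderiv ℝ (v z.1) z.2 (EuclideanSpace.single 1 1) 2 -
              fderiv ℝ (fun x => fderiv ℝ (v z.1) x (EuclideanSpace.single 2 1) 2) z.2 (EuclideanSpace.single 1 1) *
                fderiv ℝ (v z.1) z.2 (EuclideanSpace.single 0 1) 2 ≠ 0) →
          (∀ z ∈ W,
            fderiv ℝ (v z.1) z.2 (EuclideanSpace.single 2 1) 0 * fderiv ℝ (v z.1) z.2 (EuclideanSpace.single 0 1) 2 +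
              fderiv ℝ (v z.1) z.2 (EuclideanSpace.single 2 1) 1 * fderiv ℝ (v z.1) z.2 (EuclideanSpace.single 1 1) 2 < 0) →
          (∀ m : ℝ → ℝ → ℝ, ∀ W₁ : Set (ℝ × EuclideanSpace ℝ (Fin 3)), W₁ ⊆ W → IsOpen W₁ → W₁.Nonempty →
            ∃ z ∈ W₁, ∃ b : Fin 3, b ≠ 2 ∧
              fderiv ℝ (v z.1) z.2 (EuclideanSpace.single 2 1) b ≠
                m z.1 (z.2 2) * fderiv ℝ (v z.1) z.2 (EuclideanSpace.single b 1) 2) →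
          (∀ z ∈ W, ¬ Dense {y : EuclideanSpace ℝ (Fin 3) |
              fderiv ℝ (v z.1) y (EuclideanSpace.single 2 1) 0 * fderiv ℝ (v z.1) y (EuclideanSpace.single 0 1) 2 +
                fderiv ℝ (v z.1) y (EuclideanSpace.single 2 1) 1 * fderiv ℝ (v z.1) y (EuclideanSpace.single 1 1) 2 < 0}) →
          ¬ Literature.Analysis.FluidPDE.IsBackwardSingularPoint v 0) :
    ∀ (C : ℝ) (v : ℝ → EuclideanSpace ℝ (Fin 3) → EuclideanSpace ℝ (Fin 3)),
      Literature.Analysis.FluidPDE.HasTypeITimeDecay C v →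
      ContinuousOn (Function.uncurry v) (Set.Iio (0 : ℝ) ×ˢ Set.univ) →
      (∀ s t : ℝ, s < t → t < 0 → ∀ x, v t x =
        Literature.Analysis.UnboundedOperators.heatExtension (v s) (t - s) x -
          Literature.Analysis.FluidPDE.oseenDuhamel 1 s v v t x) →
      (∀ t < 0, Literature.Analysis.FluidPDE.VectorCalculus.IsDivFree (v t)) →
      (∀ s < 0, ∀ y, ⟪Literature.Analysis.FluidPDE.curl (v s) y, EuclideanSpace.single 2 1⟫_ℝ = 0) →
      ∀ W : Set (ℝ × EuclideanSpace ℝ (Fin 3)), IsOpen W → W.Nonempty → W ⊆ Set.Iio (0 : ℝ) ×ˢ Set.univ →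
        (∀ z ∈ W, Literature.Analysis.FluidPDE.curl (v z.1) z.2 ≠ 0 ∧
          (fderiv ℝ (v z.1) z.2 (EuclideanSpace.single 0 1) 2 ≠ 0 ∨ fderiv ℝ (v z.1) z.2 (EuclideanSpace.single 1 1) 2 ≠ 0) ∧
          (fderiv ℝ (v z.1) z.2 (EuclideanSpace.single 2 1) 0 ≠ 0 ∨ fderiv ℝ (v z.1) z.2 (EuclideanSpace.single 2 1) 1 ≠ 0)) →
        (∀ m : ℝ → ℝ, ∀ W₁ : Set (ℝ × EuclideanSpace ℝ (Fin 3)), W₁ ⊆ W → IsOpen W₁ → W₁.Nonempty →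
          ∃ z ∈ W₁, ∃ b : Fin 3, b ≠ 2 ∧
            fderiv ℝ (v z.1) z.2 (EuclideanSpace.single 2 1) b ≠
              m z.1 * fderiv ℝ (v z.1) z.2 (EuclideanSpace.single b 1) 2) →
        (∀ z ∈ W,
          fderiv ℝ (fun x => fderiv ℝ (v z.1) x (EuclideanSpace.single 2 1) 2) z.2 (EuclideanSpace.single 0 1) *
              fderiv ℝ (v z.1) z.2 (EuclideanSpace.single 1 1) 2 -
            fderiv ℝ (fun x => fderiv ℝ (v z.1) x (EuclideanSpace.single 2 1) 2) z.2 (EuclideanSpace.single 1 1) *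
              fderiv ℝ (v z.1) z.2 (EuclideanSpace.single 0 1) 2 ≠ 0) →
        (∀ z ∈ W,
          fderiv ℝ (v z.1) z.2 (EuclideanSpace.single 2 1) 0 * fderiv ℝ (v z.1) z.2 (EuclideanSpace.single 0 1) 2 +
            fderiv ℝ (v z.1) z.2 (EuclideanSpace.single 2 1) 1 * fderiv ℝ (v z.1) z.2 (EuclideanSpace.single 1 1) 2 < 0) →
        (∀ m : ℝ → ℝ → ℝ, ∀ W₁ : Set (ℝ × EuclideanSpace ℝ (Fin 3)), W₁ ⊆ W → IsOpen W₁ → W₁.Nonempty →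
          ∃ z ∈ W₁, ∃ b : Fin 3, b ≠ 2 ∧
            fderiv ℝ (v z.1) z.2 (EuclideanSpace.single 2 1) b ≠
              m z.1 (z.2 2) * fderiv ℝ (v z.1) z.2 (EuclideanSpace.single b 1) 2) →
        ∀ z₀ ∈ W, Dense {y : EuclideanSpace ℝ (Fin 3) |
            fderiv ℝ (v z₀.1) y (EuclideanSpace.single 2 1) 0 * fderiv ℝ (v z₀.1) y (EuclideanSpace.single 0 1) 2 +
              fderiv ℝ (v z₀.1) y (EuclideanSpace.single 2 1) 1 * fderiv ℝ (v z₀.1) y (EuclideanSpace.single 1 1) 2 < 0} →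
        (∃ g : ℝ → ℝ → ℝ, ∃ W₁ : Set (ℝ × EuclideanSpace ℝ (Fin 3)), W₁ ⊆ W ∧ IsOpen W₁ ∧ z₀ ∈ W₁ ∧
          ∀ z ∈ W₁, ∀ b : Fin 3, b ≠ 2 →
            fderiv ℝ (v z.1) z.2 (EuclideanSpace.single 2 1) b =
              g z.1 (v z.1 z.2 2) * fderiv ℝ (v z.1) z.2 (EuclideanSpace.single b 1) 2) →
        ¬ Literature.Analysis.FluidPDE.IsBackwardSingularPoint v 0 := by
  intro C v hrate hcont hmild hdiv hpol W hW hWne hWs hnd hpin htw hhyp hthick z₀ hz₀ _hD hA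
  obtain ⟨g, W₁, hW₁W, hW₁o, hz₀W₁, haut⟩ := hA
  by_cases hcase : ∃ z₁ ∈ W, Dense {y : EuclideanSpace ℝ (Fin 3) |
        fderiv ℝ (v z₁.1) y (EuclideanSpace.single 2 1) 0 * fderiv ℝ (v z₁.1) y (EuclideanSpace.single 0 1) 2 +
          fderiv ℝ (v z₁.1) y (EuclideanSpace.single 2 1) 1 * fderiv ℝ (v z₁.1) y (EuclideanSpace.single 1 1) 2 < 0} ∧
      ∃ b : Fin 3, b ≠ 2 ∧ ∃ x p : EuclideanSpace ℝ (Fin 3),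
        fderiv ℝ (v z₁.1) x (EuclideanSpace.single b 1) 2 *
            fderiv ℝ (fun y => fderiv ℝ (v z₁.1) y (EuclideanSpace.single 2 1) b) x p -
          fderiv ℝ (v z₁.1) x (EuclideanSpace.single 2 1) b *
            fderiv ℝ (fun y => fderiv ℝ (v z₁.1) y (EuclideanSpace.single b 1) 2) x p ≠ 0
  · -- a densely hyperbolic slice with a genuinely nonlinear point: the slice Liouville statement
    obtain ⟨z₁, hz₁, hD₁, hgn⟩ := hcase
    exact (false_of_sliceLiouville_of_gnPoint hGN hrate hcont hmild hdiv hpol hW₁o (hW₁W.trans hWs) ⟨z₀, hz₀W₁⟩ haut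
      (Set.mem_prod.1 (hWs hz₁)).1 hD₁ ⟨z₁.2, hhyp z₁ hz₁⟩ ⟨z₁.2, htw z₁ hz₁⟩ hgn).elim
  · -- every densely hyperbolic window time is a (TH)-instant: a mixed-pocket sub-window
    push Not at hcase
    obtain ⟨W', hW'W, hW'o, hW'ne, hpk⟩ := exists_pocketWindow_of_thInstants C v hrate hcont hmild hdiv hpol hW hWs
      (fun z hz => (hnd z hz).2.1) hhyp hthick hz₀ hcase
    exact hPocket C v hrate hcont hmild hdiv hpol W' hW'o hW'ne (hW'W.trans hWs) (fun z hz => hnd z (hW'W hz))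
      (fun m W₂ hW₂ hW₂o hW₂ne => hpin m W₂ (hW₂.trans hW'W) hW₂o hW₂ne) (fun z hz => htw z (hW'W hz))
      (fun z hz => hhyp z (hW'W hz)) (fun m W₂ hW₂ hW₂o hW₂ne => hthick m W₂ (hW₂.trans hW'W) hW₂o hW₂ne) hpk

/-- **`mixed_type`'s `stub_hyperbolicThick` (`hHT`, VERBATIM; = the skeleton's `hyperbolicThick_of_zShock`) from `hGN`, the
modulated residue `stub_zShockThickMod` (`hMod`, VERBATIM) and the mixed-pocket residue `stub_mixedPocketThick` (`hPocket`, VERBATIM)** —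
the skeleton's own split (`zShockThick_of_autSplit`, `hyperbolicThick_of_zShock`) with the deciding stub discharged by
`stub_zShockThickAut_of_sliceLiouville_of_mixedPocket`.  No new residue. [folklore] -/
theorem hyperbolicThick_of_sliceLiouville
    (hGN : ∀ (u : EuclideanSpace ℝ (Fin 3) → EuclideanSpace ℝ (Fin 3)),
      AnalyticOnNhd ℝ u Set.univ →
      (∃ M : ℝ, ∀ x, ‖u x‖ ≤ M) →
      (∃ M₁ : ℝ, ∀ x, ‖fderiv ℝ u x‖ ≤ M₁) →
      Literature.Analysis.FluidPDE.VectorCalculus.IsDivFree u →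
      (∀ y, ⟪Literature.Analysis.FluidPDE.curl u y, EuclideanSpace.single 2 1⟫_ℝ = 0) →
      (∀ y, fderiv ℝ u y (EuclideanSpace.single 2 1) 0 * fderiv ℝ u y (EuclideanSpace.single 1 1) 2 -
        fderiv ℝ u y (EuclideanSpace.single 2 1) 1 * fderiv ℝ u y (EuclideanSpace.single 0 1) 2 = 0) →
      (∀ b : Fin 3, b ≠ 2 → ∀ x p q : EuclideanSpace ℝ (Fin 3),
        (fderiv ℝ u x (EuclideanSpace.single b 1) 2 *
              fderiv ℝ (fun y => fderiv ℝ u y (EuclideanSpace.single 2 1) b) x p -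
            fderiv ℝ u x (EuclideanSpace.single 2 1) b *
              fderiv ℝ (fun y => fderiv ℝ u y (EuclideanSpace.single b 1) 2) x p) *
            fderiv ℝ (fun y => u y 2) x q -
          (fderiv ℝ u x (EuclideanSpace.single b 1) 2 *
              fderiv ℝ (fun y => fderiv ℝ u y (EuclideanSpace.single 2 1) b) x q -
            fderiv ℝ u x (EuclideanSpace.single 2 1) b *
              fderiv ℝ (fun y => fderiv ℝ u y (EuclideanSpace.single b 1) 2) x q) *
            fderiv ℝ (fun y => u y 2) x p = 0) →
      (∀ y, fderiv ℝ u y (EuclideanSpace.single 2 1) 0 * fderiv ℝ u y (EuclideanSpace.single 0 1) 2 +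
        fderiv ℝ u y (EuclideanSpace.single 2 1) 1 * fderiv ℝ u y (EuclideanSpace.single 1 1) 2 ≤ 0) →
      (∃ y, fderiv ℝ u y (EuclideanSpace.single 2 1) 0 * fderiv ℝ u y (EuclideanSpace.single 0 1) 2 +
        fderiv ℝ u y (EuclideanSpace.single 2 1) 1 * fderiv ℝ u y (EuclideanSpace.single 1 1) 2 < 0) →
      (∃ y, fderiv ℝ (fun x => fderiv ℝ u x (EuclideanSpace.single 2 1) 2) y (EuclideanSpace.single 0 1) *
            fderiv ℝ u y (EuclideanSpace.single 1 1) 2 -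
          fderiv ℝ (fun x => fderiv ℝ u x (EuclideanSpace.single 2 1) 2) y (EuclideanSpace.single 1 1) *
            fderiv ℝ u y (EuclideanSpace.single 0 1) 2 ≠ 0) →
      (∃ b : Fin 3, b ≠ 2 ∧ ∃ x p : EuclideanSpace ℝ (Fin 3),
        fderiv ℝ u x (EuclideanSpace.single b 1) 2 *
            fderiv ℝ (fun y => fderiv ℝ u y (EuclideanSpace.single 2 1) b) x p -
          fderiv ℝ u x (EuclideanSpace.single 2 1) b *
            fderiv ℝ (fun y => fderiv ℝ u y (EuclideanSpace.single b 1) 2) x p ≠ 0) →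
      False)
    (hMod : ∀ (C : ℝ) (v : ℝ → EuclideanSpace ℝ (Fin 3) → EuclideanSpace ℝ (Fin 3)),
        Literature.Analysis.FluidPDE.HasTypeITimeDecay C v →
        ContinuousOn (Function.uncurry v) (Set.Iio (0 : ℝ) ×ˢ Set.univ) →
        (∀ s t : ℝ, s < t → t < 0 → ∀ x, v t x =
          Literature.Analysis.UnboundedOperators.heatExtension (v s) (t - s) x -
            Literature.Analysis.FluidPDE.oseenDuhamel 1 s v v t x) →
        (∀ t < 0, Literature.Analysis.FluidPDE.VectorCalculus.IsDivFree (v t)) →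
        (∀ s < 0, ∀ y, ⟪Literature.Analysis.FluidPDE.curl (v s) y, EuclideanSpace.single 2 1⟫_ℝ = 0) →
        ∀ W : Set (ℝ × EuclideanSpace ℝ (Fin 3)), IsOpen W → W.Nonempty → W ⊆ Set.Iio (0 : ℝ) ×ˢ Set.univ →
          (∀ z ∈ W, Literature.Analysis.FluidPDE.curl (v z.1) z.2 ≠ 0 ∧
            (fderiv ℝ (v z.1) z.2 (EuclideanSpace.single 0 1) 2 ≠ 0 ∨ fderiv ℝ (v z.1) z.2 (EuclideanSpace.single 1 1) 2 ≠ 0) ∧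
            (fderiv ℝ (v z.1) z.2 (EuclideanSpace.single 2 1) 0 ≠ 0 ∨ fderiv ℝ (v z.1) z.2 (EuclideanSpace.single 2 1) 1 ≠ 0)) →
          (∀ m : ℝ → ℝ, ∀ W₁ : Set (ℝ × EuclideanSpace ℝ (Fin 3)), W₁ ⊆ W → IsOpen W₁ → W₁.Nonempty →
            ∃ z ∈ W₁, ∃ b : Fin 3, b ≠ 2 ∧
              fderiv ℝ (v z.1) z.2 (EuclideanSpace.single 2 1) b ≠
                m z.1 * fderiv ℝ (v z.1) z.2 (EuclideanSpace.single b 1) 2) →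
          (∀ z ∈ W,
            fderiv ℝ (fun x => fderiv ℝ (v z.1) x (EuclideanSpace.single 2 1) 2) z.2 (EuclideanSpace.single 0 1) *
                fderiv ℝ (v z.1) z.2 (EuclideanSpace.single 1 1) 2 -
              fderiv ℝ (fun x => fderiv ℝ (v z.1) x (EuclideanSpace.single 2 1) 2) z.2 (EuclideanSpace.single 1 1) *
                fderiv ℝ (v z.1) z.2 (EuclideanSpace.single 0 1) 2 ≠ 0) →
          (∀ z ∈ W,
            fderiv ℝ (v z.1) z.2 (EuclideanSpace.single 2 1) 0 * fderiv ℝ (v z.1) z.2 (EuclideanSpace.single 0 1) 2 +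
              fderiv ℝ (v z.1) z.2 (EuclideanSpace.single 2 1) 1 * fderiv ℝ (v z.1) z.2 (EuclideanSpace.single 1 1) 2 < 0) →
          (∀ m : ℝ → ℝ → ℝ, ∀ W₁ : Set (ℝ × EuclideanSpace ℝ (Fin 3)), W₁ ⊆ W → IsOpen W₁ → W₁.Nonempty →
            ∃ z ∈ W₁, ∃ b : Fin 3, b ≠ 2 ∧
              fderiv ℝ (v z.1) z.2 (EuclideanSpace.single 2 1) b ≠
                m z.1 (z.2 2) * fderiv ℝ (v z.1) z.2 (EuclideanSpace.single b 1) 2) →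
          ∀ z₀ ∈ W, Dense {y : EuclideanSpace ℝ (Fin 3) |
              fderiv ℝ (v z₀.1) y (EuclideanSpace.single 2 1) 0 * fderiv ℝ (v z₀.1) y (EuclideanSpace.single 0 1) 2 +
                fderiv ℝ (v z₀.1) y (EuclideanSpace.single 2 1) 1 * fderiv ℝ (v z₀.1) y (EuclideanSpace.single 1 1) 2 < 0} →
          (∀ g : ℝ → ℝ → ℝ, ∀ W₁ : Set (ℝ × EuclideanSpace ℝ (Fin 3)), W₁ ⊆ W → IsOpen W₁ → z₀ ∈ W₁ →
            ∃ z ∈ W₁, ∃ b : Fin 3, b ≠ 2 ∧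
              fderiv ℝ (v z.1) z.2 (EuclideanSpace.single 2 1) b ≠
                g z.1 (v z.1 z.2 2) * fderiv ℝ (v z.1) z.2 (EuclideanSpace.single b 1) 2) →
          ¬ Literature.Analysis.FluidPDE.IsBackwardSingularPoint v 0)
    (hPocket : ∀ (C : ℝ) (v : ℝ → EuclideanSpace ℝ (Fin 3) → EuclideanSpace ℝ (Fin 3)),
        Literature.Analysis.FluidPDE.HasTypeITimeDecay C v →
        ContinuousOn (Function.uncurry v) (Set.Iio (0 : ℝ) ×ˢ Set.univ) →
        (∀ s t : ℝ, s < t → t < 0 → ∀ x, v t x =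
          Literature.Analysis.UnboundedOperators.heatExtension (v s) (t - s) x -
            Literature.Analysis.FluidPDE.oseenDuhamel 1 s v v t x) →
        (∀ t < 0, Literature.Analysis.FluidPDE.VectorCalculus.IsDivFree (v t)) →
        (∀ s < 0, ∀ y, ⟪Literature.Analysis.FluidPDE.curl (v s) y, EuclideanSpace.single 2 1⟫_ℝ = 0) →
        ∀ W : Set (ℝ × EuclideanSpace ℝ (Fin 3)), IsOpen W → W.Nonempty → W ⊆ Set.Iio (0 : ℝ) ×ˢ Set.univ →
          (∀ z ∈ W, Literature.Analysis.FluidPDE.curl (v z.1) z.2 ≠ 0 ∧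
            (fderiv ℝ (v z.1) z.2 (EuclideanSpace.single 0 1) 2 ≠ 0 ∨ fderiv ℝ (v z.1) z.2 (EuclideanSpace.single 1 1) 2 ≠ 0) ∧
            (fderiv ℝ (v z.1) z.2 (EuclideanSpace.single 2 1) 0 ≠ 0 ∨ fderiv ℝ (v z.1) z.2 (EuclideanSpace.single 2 1) 1 ≠ 0)) →
          (∀ m : ℝ → ℝ, ∀ W₁ : Set (ℝ × EuclideanSpace ℝ (Fin 3)), W₁ ⊆ W → IsOpen W₁ → W₁.Nonempty →
            ∃ z ∈ W₁, ∃ b : Fin 3, b ≠ 2 ∧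
              fderiv ℝ (v z.1) z.2 (EuclideanSpace.single 2 1) b ≠
                m z.1 * fderiv ℝ (v z.1) z.2 (EuclideanSpace.single b 1) 2) →
          (∀ z ∈ W,
            fderiv ℝ (fun x => fderiv ℝ (v z.1) x (EuclideanSpace.single 2 1) 2) z.2 (EuclideanSpace.single 0 1) *
                fderiv ℝ (v z.1) z.2 (EuclideanSpace.single 1 1) 2 -
              fderiv ℝ (fun x => fderiv ℝ (v z.1) x (EuclideanSpace.single 2 1) 2) z.2 (EuclideanSpace.single 1 1) *
                fderiv ℝ (v z.1) z.2 (EuclideanSpace.single 0 1) 2 ≠ 0) →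
          (∀ z ∈ W,
            fderiv ℝ (v z.1) z.2 (EuclideanSpace.single 2 1) 0 * fderiv ℝ (v z.1) z.2 (EuclideanSpace.single 0 1) 2 +
              fderiv ℝ (v z.1) z.2 (EuclideanSpace.single 2 1) 1 * fderiv ℝ (v z.1) z.2 (EuclideanSpace.single 1 1) 2 < 0) →
          (∀ m : ℝ → ℝ → ℝ, ∀ W₁ : Set (ℝ × EuclideanSpace ℝ (Fin 3)), W₁ ⊆ W → IsOpen W₁ → W₁.Nonempty →
            ∃ z ∈ W₁, ∃ b : Fin 3, b ≠ 2 ∧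
              fderiv ℝ (v z.1) z.2 (EuclideanSpace.single 2 1) b ≠
                m z.1 (z.2 2) * fderiv ℝ (v z.1) z.2 (EuclideanSpace.single b 1) 2) →
          (∀ z ∈ W, ¬ Dense {y : EuclideanSpace ℝ (Fin 3) |
              fderiv ℝ (v z.1) y (EuclideanSpace.single 2 1) 0 * fderiv ℝ (v z.1) y (EuclideanSpace.single 0 1) 2 +
                fderiv ℝ (v z.1) y (EuclideanSpace.single 2 1) 1 * fderiv ℝ (v z.1) y (EuclideanSpace.single 1 1) 2 < 0}) →
          ¬ Literature.Analysis.FluidPDE.IsBackwardSingularPoint v 0) :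
    ∀ (C : ℝ) (v : ℝ → EuclideanSpace ℝ (Fin 3) → EuclideanSpace ℝ (Fin 3)),
      Literature.Analysis.FluidPDE.HasTypeITimeDecay C v →
      ContinuousOn (Function.uncurry v) (Set.Iio (0 : ℝ) ×ˢ Set.univ) →
      (∀ s t : ℝ, s < t → t < 0 → ∀ x, v t x =
        Literature.Analysis.UnboundedOperators.heatExtension (v s) (t - s) x -
          Literature.Analysis.FluidPDE.oseenDuhamel 1 s v v t x) →
      (∀ t < 0, Literature.Analysis.FluidPDE.VectorCalculus.IsDivFree (v t)) →
      (∀ s < 0, ∀ y, ⟪Literature.Analysis.FluidPDE.curl (v s) y, EuclideanSpace.single 2 1⟫_ℝ = 0) →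
      ∀ W : Set (ℝ × EuclideanSpace ℝ (Fin 3)), IsOpen W → W.Nonempty → W ⊆ Set.Iio (0 : ℝ) ×ˢ Set.univ →
        (∀ z ∈ W, Literature.Analysis.FluidPDE.curl (v z.1) z.2 ≠ 0 ∧
          (fderiv ℝ (v z.1) z.2 (EuclideanSpace.single 0 1) 2 ≠ 0 ∨ fderiv ℝ (v z.1) z.2 (EuclideanSpace.single 1 1) 2 ≠ 0) ∧
          (fderiv ℝ (v z.1) z.2 (EuclideanSpace.single 2 1) 0 ≠ 0 ∨ fderiv ℝ (v z.1) z.2 (EuclideanSpace.single 2 1) 1 ≠ 0)) →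
        (∀ m : ℝ → ℝ, ∀ W₁ : Set (ℝ × EuclideanSpace ℝ (Fin 3)), W₁ ⊆ W → IsOpen W₁ → W₁.Nonempty →
          ∃ z ∈ W₁, ∃ b : Fin 3, b ≠ 2 ∧
            fderiv ℝ (v z.1) z.2 (EuclideanSpace.single 2 1) b ≠
              m z.1 * fderiv ℝ (v z.1) z.2 (EuclideanSpace.single b 1) 2) →
        (∀ z ∈ W,
          fderiv ℝ (fun x => fderiv ℝ (v z.1) x (EuclideanSpace.single 2 1) 2) z.2 (EuclideanSpace.single 0 1) *
              fderiv ℝ (v z.1) z.2 (EuclideanSpace.single 1 1) 2 -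
            fderiv ℝ (fun x => fderiv ℝ (v z.1) x (EuclideanSpace.single 2 1) 2) z.2 (EuclideanSpace.single 1 1) *
              fderiv ℝ (v z.1) z.2 (EuclideanSpace.single 0 1) 2 ≠ 0) →
        (∀ z ∈ W,
          fderiv ℝ (v z.1) z.2 (EuclideanSpace.single 2 1) 0 * fderiv ℝ (v z.1) z.2 (EuclideanSpace.single 0 1) 2 +
            fderiv ℝ (v z.1) z.2 (EuclideanSpace.single 2 1) 1 * fderiv ℝ (v z.1) z.2 (EuclideanSpace.single 1 1) 2 < 0) →
        (∀ m : ℝ → ℝ → ℝ, ∀ W₁ : Set (ℝ × EuclideanSpace ℝ (Fin 3)), W₁ ⊆ W → IsOpen W₁ → W₁.Nonempty →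
          ∃ z ∈ W₁, ∃ b : Fin 3, b ≠ 2 ∧
            fderiv ℝ (v z.1) z.2 (EuclideanSpace.single 2 1) b ≠
              m z.1 (z.2 2) * fderiv ℝ (v z.1) z.2 (EuclideanSpace.single b 1) 2) →
        ¬ Literature.Analysis.FluidPDE.IsBackwardSingularPoint v 0 := by
  intro C v hrate hcont hmild hdiv hpol W hW hWne hWs hnd hpin htw hhyp hthick
  by_cases hDex : ∃ z ∈ W, Dense {y : EuclideanSpace ℝ (Fin 3) |
      fderiv ℝ (v z.1) y (EuclideanSpace.single 2 1) 0 * fderiv ℝ (v z.1) y (EuclideanSpace.single 0 1) 2 +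
        fderiv ℝ (v z.1) y (EuclideanSpace.single 2 1) 1 * fderiv ℝ (v z.1) y (EuclideanSpace.single 1 1) 2 < 0}
  · obtain ⟨z₀, hz₀, hD⟩ := hDex
    by_cases hA : ∃ g : ℝ → ℝ → ℝ, ∃ W₁ : Set (ℝ × EuclideanSpace ℝ (Fin 3)), W₁ ⊆ W ∧ IsOpen W₁ ∧ z₀ ∈ W₁ ∧
        ∀ z ∈ W₁, ∀ b : Fin 3, b ≠ 2 →
          fderiv ℝ (v z.1) z.2 (EuclideanSpace.single 2 1) b =
            g z.1 (v z.1 z.2 2) * fderiv ℝ (v z.1) z.2 (EuclideanSpace.single b 1) 2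
    · exact stub_zShockThickAut_of_sliceLiouville_of_mixedPocket hGN hPocket C v hrate hcont hmild hdiv hpol W hW hWne hWs hnd
        hpin htw hhyp hthick z₀ hz₀ hD hA
    · push Not at hA
      exact hMod C v hrate hcont hmild hdiv hpol W hW hWne hWs hnd hpin htw hhyp hthick z₀ hz₀ hD hA
  · have hD' : ∀ z ∈ W, ¬ Dense {y : EuclideanSpace ℝ (Fin 3) |
        fderiv ℝ (v z.1) y (EuclideanSpace.single 2 1) 0 * fderiv ℝ (v z.1) y (EuclideanSpace.single 0 1) 2 +
          fderiv ℝ (v z.1) y (EuclideanSpace.single 2 1) 1 * fderiv ℝ (v z.1) y (EuclideanSpace.single 1 1) 2 < 0} :=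
      fun z hz h => hDex ⟨z, hz, h⟩
    exact hPocket C v hrate hcont hmild hdiv hpol W hW hWne hWs hnd hpin htw hhyp hthick hD'

end Summit.NavierStokesRegularity.NavierStokesRegularity.Theorems.PoloidalWindowDoorPoloidalWindowRigidityZShockAutOfSliceLiouville
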